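import Summits.CriticalPhenomena.PercolationContinuityZ3.Theorems.PercNearOneGluingNoHeavyLowerTailKnQuestion8CoefficientwiseRootEdgePoint
import Summits.CriticalPhenomena.PercolationContinuityZ3.Theorems.PercNearOneGluingNoHeavyLowerTailKnQuestion8CoefficientwiseRootEdgeAnatomyA
import HarnessLib

/-!
# Root-edge corollaries: `S′_{D1} ≥ 0 ⇒` NO-CORE at a root-adjacent point; `S_{D2} ≥ 0 ⇒` root-edge monotonicity — prim-lf-2 gen 53 (part 6b)

Support file (`--supports stmt-CriticalPhenomena-4575`, closed), prover `prim-lf-2` (gen 53).  No definitions, no named facts, no sorries; standard axioms.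
Memo `prim-lf-2/CW-SERIES-gen53.md` §7.4–7.7.  Part 3 (`…CoefficientwiseRootEdgePoint.lean`): for a root edge `e = xu`, `NO-CORE^G(y)[1_u,g] = 2·H` with `H` computed on `G − e`;
part 6a (`…CoefficientwiseRootEdgeAnatomyA.lean`): on any multigraph `H ≥ S′_{D1}` and `2H ≥ NO-CORE + 2·S_{D2}`.  Here, for a root edge `e = xu` (`u ≠ x`), a vertex `y`, a monotone `g`,
with `K′ = C_x`, `U′ = C_u` on `G − e` (edge type `{j // j ∉ {e}}`) and bars = complement colouring:
* `noCore_rootAdj_ge_twice_sprimeD1` — `2·S′_{D1} ≤ NO-CORE^G(y)[1_u,g]`, `S′_{D1} = Σ_{t : u ∈ K̄′∖K′, ¬(y ∈ K̄′ ∧ y ∈ K′∪U′)} (g(K̄′) − g(K′))`;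
* `noCore_rootAdj_nonneg_of_sprimeD1` — hence `S′_{D1} ≥ 0` on `G − e` implies `NO-CORE^G(y)[1_u,g] ≥ 0` (S′_{D1} ≥ 0 is weaker than CLAIM B of part 3; census-clean on all graphs with
  ≤ 7 vertices and on LOBE(2,2)…(5,5), prim-lf-2 gen 53 adv53.c; it is the single open atom of CONJECTURE NO-CORE at root-adjacent points);
* `noCore_deleted_add_le_noCore_rootEdge` — `NO-CORE^{G−e}(y)[1_u,g] + 2·S_{D2} ≤ NO-CORE^G(y)[1_u,g]`, `S_{D2} = Σ_{t : u ∉ K′∪K̄′, y ∈ U′ ∩ K̄′} (g(K̄′ ∪ Ū′) − g(K′))` (raw sums: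
  `2^{m−1}` colourings on the left, `2^m` on the right);
* `noCore_rootEdge_mono_of_sD2` — hence `S_{D2} ≥ 0` on `G − e` implies ROOT-EDGE MONOTONICITY `NO-CORE^{G−e}(y)[1_u,g] ≤ NO-CORE^G(y)[1_u,g]` — the `p = x` companion of
  CONJECTURE PEM (point-edge monotonicity, memo §9, `…CoefficientwisePointEdgeReduction.lean`).
[cite: KozmaNitzan2024, Questions 8–9 (§5.5 p. 36) (context: the Question-8 pocket covariance programme)]
-/

namespace Summit.CriticalPhenomena.PercolationContinuityZ3.Theorems

open Finset Literature.Probability.Percolation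

namespace Coefficientwise

variable {ι V : Type*} [Fintype ι] [DecidableEq ι] (ends : ι → Sym2 V) (x : V)

section rootEdge
variable {u : V} (y : V) {e : ι} (g : Set V → ℝ)


open Classical in
/-- **`NO-CORE(y)[1_u,g] ≥ 2·S′_{D1}` at a point adjacent to the root.**  For a root edge `e = xu` (`u ≠ x`), a vertex `y` and a monotone `g`, with `K′ = C_x`, `U′ = C_u` on `G − e`:
`2·Σ_{t : u ∈ K̄′∖K′, ¬(y ∈ K̄′ ∧ y ∈ K′∪U′)} (g(K̄′) − g(K′)) ≤ NO-CORE(y)[1_u,g]` (part 3's root-edge identity + `rootEdge_half_ge_sprimeD1` on `G − e`).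
[cite: KozmaNitzan2024, Questions 8–9 (§5.5 p. 36) (context)] -/
theorem noCore_rootAdj_ge_twice_sprimeD1 (he : ends e = s(u, x)) (hxu : x ≠ u) (hg : Monotone g) :
    2 * ∑ t ∈ univ.filter (fun t : Finset {j : ι // j ∉ ({e} : Finset ι)} =>
          (u ∈ (openCluster ((fun j : {j : ι // j ∉ ({e} : Finset ι)} => ends j.1) '' (↑(tᶜ) : Set {j : ι // j ∉ ({e} : Finset ι)})) x) ∧ u ∉ (openCluster ((fun j : {j : ι // j ∉ ({e} : Finset ι)} => ends j.1) '' (↑(t) : Set {j : ι // j ∉ ({e} : Finset ι)})) x)) ∧ ¬ (y ∈ (openCluster ((fun j : {j : ι // j ∉ ({e} : Finset ι)} => ends j.1) '' (↑(tᶜ) : Set {j : ι // j ∉ ({e} : Finset ι)})) x) ∧ y ∈ (openCluster ((fun j : {j : ι // j ∉ ({e} : Finset ι)} => ends j.1) '' (↑(t) : Set {j : ι // j ∉ ({e} : Finset ι)})) x) ∪ (openCluster ((fun j : {j : ι // j ∉ ({e} : Finset ι)} => ends j.1) '' (↑(t) : Set {j : ι // j ∉ ({e} : Finset ι)})) u))),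 (g (openCluster ((fun j : {j : ι // j ∉ ({e} : Finset ι)} => ends j.1) '' (↑(tᶜ) : Set {j : ι // j ∉ ({e} : Finset ι)})) x) - g (openCluster ((fun j : {j : ι // j ∉ ({e} : Finset ι)} => ends j.1) '' (↑(t) : Set {j : ι // j ∉ ({e} : Finset ι)})) x)) ≤ (∑ s ∈ univ.filter (fun s : Finset ι => ¬ (y ∈ openCluster (ends '' (↑s : Set ι)) x ∧ y ∈ openCluster (ends '' (↑(sᶜ) : Set ι)) x)),
      ((if u ∈ openCluster (ends '' (↑s : Set ι)) x then (1 : ℝ) else 0) - (if u ∈ openCluster (ends '' (↑(sᶜ) : Set ι)) x then (1 : ℝ) else 0)) *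
        (g (openCluster (ends '' (↑s : Set ι)) x) - g (openCluster (ends '' (↑(sᶜ) : Set ι)) x))) := by
  rw [noCore_rootEdge_eq ends x g he hxu y, ← Finset.sum_filter]
  have h := rootEdge_half_ge_sprimeD1 (fun j : {j : ι // j ∉ ({e} : Finset ι)} => ends j.1) x u y g hg
  linarith

open Classical in
/-- **`S′_{D1} ≥ 0` implies CONJECTURE NO-CORE at every point adjacent to the root.**  For a root edge `e = xu` (`u ≠ x`), a vertex `y` and a monotone `g`: if on `G − e`
`0 ≤ Σ_{t : u ∈ K̄′∖K′, ¬(y ∈ K̄′ ∧ y ∈ K′∪U′)} (g(K̄′) − g(K′))` then `0 ≤ NO-CORE(y)[1_u,g]`.  (`S′_{D1} ≥ 0` is weaker than CLAIM B of part 3 and census-clean on all graphs with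
≤ 7 vertices; it is the single open atom at root-adjacent points.)  [cite: KozmaNitzan2024, Questions 8–9 (§5.5 p. 36) (context)] -/
theorem noCore_rootAdj_nonneg_of_sprimeD1 (he : ends e = s(u, x)) (hxu : x ≠ u) (hg : Monotone g)
    (hD : 0 ≤ ∑ t ∈ univ.filter (fun t : Finset {j : ι // j ∉ ({e} : Finset ι)} =>
          (u ∈ (openCluster ((fun j : {j : ι // j ∉ ({e} : Finset ι)} => ends j.1) '' (↑(tᶜ) : Set {j : ι // j ∉ ({e} : Finset ι)})) x) ∧ u ∉ (openCluster ((fun j : {j : ι // j ∉ ({e} : Finset ι)} => ends j.1) '' (↑(t) : Set {j : ι // j ∉ ({e} : Finset ι)})) x)) ∧ ¬ (y ∈ (openCluster ((fun j : {j : ι // j ∉ ({e} : Finset ι)} => ends j.1) '' (↑(tᶜ) : Set {j : ι // j ∉ ({e} : Finset ι)})) x) ∧ y ∈ (openCluster ((fun j : {j : ι // j ∉ ({e} : Finset ι)} => ends j.1) '' (↑(t) : Set {j : ι // j ∉ ({e} : Finset ι)})) x) ∪ (openCluster ((fun j : {j : ι // j ∉ ({e} : Finset ι)} => ends j.1) ''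 (↑(t) : Set {j : ι // j ∉ ({e} : Finset ι)})) u))), (g (openCluster ((fun j : {j : ι // j ∉ ({e} : Finset ι)} => ends j.1) '' (↑(tᶜ) : Set {j : ι // j ∉ ({e} : Finset ι)})) x) - g (openCluster ((fun j : {j : ι // j ∉ ({e} : Finset ι)} => ends j.1) '' (↑(t) : Set {j : ι // j ∉ ({e} : Finset ι)})) x))) :
    0 ≤ (∑ s ∈ univ.filter (fun s : Finset ι => ¬ (y ∈ openCluster (ends '' (↑s : Set ι)) x ∧ y ∈ openCluster (ends '' (↑(sᶜ) : Set ι)) x)),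
      ((if u ∈ openCluster (ends '' (↑s : Set ι)) x then (1 : ℝ) else 0) - (if u ∈ openCluster (ends '' (↑(sᶜ) : Set ι)) x then (1 : ℝ) else 0)) *
        (g (openCluster (ends '' (↑s : Set ι)) x) - g (openCluster (ends '' (↑(sᶜ) : Set ι)) x))) := by
  have h := noCore_rootAdj_ge_twice_sprimeD1 ends x y g he hxu hg
  linarith

open Classical in
/-- **`NO-CORE^{G−e}(y)[1_u,g] + 2·S_{D2} ≤ NO-CORE^G(y)[1_u,g]`** for a root edge `e = xu` (`u ≠ x`), a vertex `y` and a monotone `g`; the left no-core sum and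
`S_{D2} = Σ_{t : u ∉ K′∪K̄′, y ∈ U′ ∩ K̄′} (g(K̄′ ∪ Ū′) − g(K′))` on `G − e` (part 3's root-edge identity + `rootEdge_half_ge_halfNoCore_add_sD2`).
[cite: KozmaNitzan2024, Questions 8–9 (§5.5 p. 36) (context)] -/
theorem noCore_deleted_add_le_noCore_rootEdge (he : ends e = s(u, x)) (hxu : x ≠ u) (hg : Monotone g) :
    ∑ s ∈ univ.filter (fun s : Finset {j : ι // j ∉ ({e} : Finset ι)} => ¬ (y ∈ (openCluster ((fun j : {j : ι // j ∉ ({e} : Finset ι)} => ends j.1) '' (↑(s) : Set {j : ι // j ∉ ({e} : Finset ι)})) x) ∧ y ∈ (openCluster ((fun j : {j : ι // j ∉ ({e} : Finset ι)} => ends j.1) '' (↑(sᶜ) : Set {j : ι // j ∉ ({e} : Finset ι)})) x))),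
      ((if u ∈ (openCluster ((fun j : {j : ι // j ∉ ({e} : Finset ι)} => ends j.1) '' (↑(s) : Set {j : ι // j ∉ ({e} : Finset ι)})) x) then (1 : ℝ) else 0) - (if u ∈ (openCluster ((fun j : {j : ι // j ∉ ({e} : Finset ι)} => ends j.1) '' (↑(sᶜ) : Set {j : ι // j ∉ ({e} : Finset ι)})) x) then (1 : ℝ) else 0)) * (g (openCluster ((fun j : {j : ι // j ∉ ({e} : Finset ι)} => ends j.1) '' (↑(s) : Set {j : ι // j ∉ ({e} : Finset ι)})) x) - g (openCluster ((fun j : {j : ι // j ∉ ({e} : Finset ι)} => ends j.1) '' (↑(sᶜ) : Set {j : ι // j ∉ ({e} : Finset ι)})) x)) +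
    2 * ∑ t ∈ univ.filter (fun t : Finset {j : ι // j ∉ ({e} : Finset ι)} => (u ∉ (openCluster ((fun j : {j : ι // j ∉ ({e} : Finset ι)} => ends j.1) '' (↑(t) : Set {j : ι // j ∉ ({e} : Finset ι)})) x) ∧ u ∉ (openCluster ((fun j : {j : ι // j ∉ ({e} : Finset ι)} => ends j.1) '' (↑(tᶜ) : Set {j : ι // j ∉ ({e} : Finset ι)})) x)) ∧ (y ∈ (openCluster ((fun j : {j : ι // j ∉ ({e} : Finset ι)} => ends j.1) '' (↑(t) : Set {j : ι // j ∉ ({e} : Finset ι)})) u) ∧ y ∈ (openCluster ((fun j : {j : ι // j ∉ ({e} : Finset ι)} => ends j.1) '' (↑(tᶜ) : Set {j : ι // j ∉ ({e} : Finset ι)})) x))),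
      (g ((openCluster ((fun j : {j : ι // j ∉ ({e} : Finset ι)} => ends j.1) '' (↑(tᶜ) : Set {j : ι // j ∉ ({e} : Finset ι)})) x) ∪ (openCluster ((fun j : {j : ι // j ∉ ({e} : Finset ι)} => ends j.1) '' (↑(tᶜ) : Set {j : ι // j ∉ ({e} : Finset ι)})) u)) - g (openCluster ((fun j : {j : ι // j ∉ ({e} : Finset ι)} => ends j.1) '' (↑(t) : Set {j : ι // j ∉ ({e} : Finset ι)})) x)) ≤ (∑ s ∈ univ.filter (fun s : Finset ι => ¬ (y ∈ openCluster (ends '' (↑s : Set ι)) x ∧ y ∈ openCluster (ends '' (↑(sᶜ) : Set ι)) x)),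
      ((if u ∈ openCluster (ends '' (↑s : Set ι)) x then (1 : ℝ) else 0) - (if u ∈ openCluster (ends '' (↑(sᶜ) : Set ι)) x then (1 : ℝ) else 0)) *
        (g (openCluster (ends '' (↑s : Set ι)) x) - g (openCluster (ends '' (↑(sᶜ) : Set ι)) x))) := by
  rw [noCore_rootEdge_eq ends x g he hxu y, ← Finset.sum_filter]
  exact rootEdge_half_ge_halfNoCore_add_sD2 (fun j : {j : ι // j ∉ ({e} : Finset ι)} => ends j.1) x u y g hg

open Classical in
/-- **`S_{D2} ≥ 0` implies ROOT-EDGE MONOTONICITY `NO-CORE^{G−e}(y)[1_u,g] ≤ NO-CORE^G(y)[1_u,g]`** for a root edge `e = xu` (`u ≠ x`), a vertex `y` and a monotone `g`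
(`S_{D2}` computed on `G − e`; census-clean on all graphs with ≤ 7 vertices, not cell-positive).  [cite: KozmaNitzan2024, Questions 8–9 (§5.5 p. 36) (context)] -/
theorem noCore_rootEdge_mono_of_sD2 (he : ends e = s(u, x)) (hxu : x ≠ u) (hg : Monotone g)
    (hD2 : 0 ≤ ∑ t ∈ univ.filter (fun t : Finset {j : ι // j ∉ ({e} : Finset ι)} => (u ∉ (openCluster ((fun j : {j : ι // j ∉ ({e} : Finset ι)} => ends j.1) '' (↑(t) : Set {j : ι // j ∉ ({e} : Finset ι)})) x) ∧ u ∉ (openCluster ((fun j : {j : ι // j ∉ ({e} : Finset ι)} => ends j.1) '' (↑(tᶜ) : Set {j : ι // j ∉ ({e} : Finset ι)})) x)) ∧ (y ∈ (openCluster ((fun j : {j : ι // j ∉ ({e} : Finset ι)} => ends j.1) '' (↑(t) : Set {j : ι // j ∉ ({e} : Finset ι)})) u) ∧ y ∈ (openCluster ((fun j : {j : ι // j ∉ ({e} : Finset ι)} => ends j.1) '' (↑(tᶜ) : Set {j : ι // j ∉ ({e} : Finset ι)})) x))),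
      (g ((openCluster ((fun j : {j : ι // j ∉ ({e} : Finset ι)} => ends j.1) '' (↑(tᶜ) : Set {j : ι // j ∉ ({e} : Finset ι)})) x) ∪ (openCluster ((fun j : {j : ι // j ∉ ({e} : Finset ι)} => ends j.1) '' (↑(tᶜ) : Set {j : ι // j ∉ ({e} : Finset ι)})) u)) - g (openCluster ((fun j : {j : ι // j ∉ ({e} : Finset ι)} => ends j.1) '' (↑(t) : Set {j : ι // j ∉ ({e} : Finset ι)})) x))) :
    ∑ s ∈ univ.filter (fun s : Finset {j : ι // j ∉ ({e} : Finset ι)} => ¬ (y ∈ (openCluster ((fun j : {j : ι // j ∉ ({e} : Finset ι)} => ends j.1) '' (↑(s) : Set {j : ι // j ∉ ({e} : Finset ι)})) x) ∧ y ∈ (openCluster ((fun j : {j : ι // j ∉ ({e} : Finset ι)} => ends j.1) '' (↑(sᶜ) : Set {j : ι // j ∉ ({e} : Finset ι)})) x))),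
      ((if u ∈ (openCluster ((fun j : {j : ι // j ∉ ({e} : Finset ι)} => ends j.1) '' (↑(s) : Set {j : ι // j ∉ ({e} : Finset ι)})) x) then (1 : ℝ) else 0) - (if u ∈ (openCluster ((fun j : {j : ι // j ∉ ({e} : Finset ι)} => ends j.1) '' (↑(sᶜ) : Set {j : ι // j ∉ ({e} : Finset ι)})) x) then (1 : ℝ) else 0)) * (g (openCluster ((fun j : {j : ι // j ∉ ({e} : Finset ι)} => ends j.1) '' (↑(s) : Set {j : ι // j ∉ ({e} : Finset ι)})) x) - g (openCluster ((fun j : {j : ι // j ∉ ({e} : Finset ι)} => ends j.1) '' (↑(sᶜ) : Set {j : ι // j ∉ ({e} : Finset ι)})) x)) ≤ (∑ s ∈ univ.filter (fun s : Finset ι => ¬ (y ∈ openCluster (ends '' (↑s : Set ι)) x ∧ y ∈ openCluster (ends '' (↑(sᶜ) : Set ι)) x)),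
      ((if u ∈ openCluster (ends '' (↑s : Set ι)) x then (1 : ℝ) else 0) - (if u ∈ openCluster (ends '' (↑(sᶜ) : Set ι)) x then (1 : ℝ) else 0)) *
        (g (openCluster (ends '' (↑s : Set ι)) x) - g (openCluster (ends '' (↑(sᶜ) : Set ι)) x))) := by
  have h := noCore_deleted_add_le_noCore_rootEdge ends x y g he hxu hg
  linarith

end rootEdge

end Coefficientwise

end Summit.CriticalPhenomena.PercolationContinuityZ3.Theorems
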